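import Mathlib.Geometry.Manifold.ContMDiffMFDeriv
import Literature.Topology.FourManifolds.BandSum
import Literature.Topology.FourManifolds.IsotopyProofs
import Literature.Topology.FourManifolds.GluckTwistTransport
import HarnessLib

/-!
# Discharge for `BandSum.lean`: a knot isotopic to a connected sum is a connected sum

Sibling proof file of `Literature.Topology.FourManifolds.BandSum` (D-0014: the named fact
`def X : Prop` is discharged by `theorem X_holds : X`; the proof needs the transport
infrastructure of `IsotopyProofs.lean`, `ClosedBallProofs.lean` and `GluckTwistTransport.lean`,
which `BandSum.lean` does not import, so the discharge lives here). It proves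

* `Literature.Topology.FourManifolds.Knot.IsConnectedSum.of_isIsotopic_right_holds` — discharge of
  `Literature.Topology.FourManifolds.Knot.IsConnectedSum.of_isIsotopic_right`: if `K` is a connected sum `K₁ # K₂` (a band sum
  of split isotopic copies `K₁'`, `K₂'` of the factors along a band crossing a splitting sphere
  `S` in its middle segment, `Literature.Topology.FourManifolds.Knot.IsConnectedSum`) and `K'` is ambient isotopic to `K`, then
  `K'` is a connected sum `K₁ # K₂`.

*Proof.* `K' = φ ∘ K` for the end stage `φ = F₁` of an ambient isotopy `F` of `𝕊³`
(a diffeomorphism, `AmbientIsotopy.toDiffeomorph`). Apply `φ` to the whole configuration: the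
copies `φ ∘ Kᵢ'` are still isotopic to the factors (stagewise composition of ambient isotopies,
`IsAmbientIsotopic.trans_holds`), `φ ∘ S` still splits them (`Knot.IsSplitBy.map`: pull paths
back along `φ⁻¹`), and `φ ∘ band` with the *same* collar width and planar arcs is band-sum data
for `φ ∘ K` (`BandData.exists_map`): the set-theoretic clauses transport by injectivity of `φ`, the
immersion clause by the chain rule and invertibility of `dφ`
(`Diffeomorph.mfderivToContinuousLinearEquiv`), and the three orientation clauses — which
compare velocities in the ambient `ℝ⁴ ⊇ 𝕊³` — by `deriv_coe_comp_eq_smul_fderiv_coe_comp`: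
a relation `(ι ∘ γ)'(θ) = c · D(ι ∘ β)(p) v` between the ambient velocities of a curve `γ` and
of a surface `β` through the same point of `𝕊ⁿ` (`ι : 𝕊ⁿ ⊆ ℝⁿ⁺¹`) persists after composing
both with a smooth self-map `φ` of `𝕊ⁿ`, because `dι` is injective
(`mfderiv_coe_sphere_injective`), so the relation already holds between the tangent vectors
`dγ(θ) 1 = c · dβ(p) v` in `T𝕊ⁿ`, to which the linear map `d(ι ∘ φ)` is applied.

This is the (folklore) remark that the connected sum is an operation on oriented knot *types*:
Rolfsen, *Knots and Links* (1976), §2.G; in the form used by `BandSum.lean` (band on a split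
link crossing the splitting sphere in a single arc, "=" meaning orientation-preserving ambient
isotopy) it is Cromwell, *Knots and Links* (2004), §4.6 "The product operation" and the
footnote there (held copy, PDF p. 69).

## References

* D. Rolfsen, *Knots and Links*, Mathematics Lecture Series 7, Publish or Perish (1976), §2.G
  [Rolfsen1976] (full entry `RolfsenKL1976`).
* P. R. Cromwell, *Knots and Links*, Cambridge University Press (2004), §4.6 [Cromwell2004].
* M. W. Hirsch, *Differential Topology*, GTM 33 (1976), Ch. 8 §1 [HirschDT1976].

## Design notes

* `SphereEmbedding.map K φ = φ ∘ K` is the tree's (`GluckTwistTransport.lean`);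
  `BandData.exists_map` and `Knot.IsSplitBy.map` are the analogous transports introduced here
  (the former as an existence statement, since band-sum data are only ever used existentially:
  `Knot.IsBandSum`, `Knot.IsConnectedSum`). The file declares theorems only.
* The velocity lemmas are stated in Mathlib's generality for the unit sphere of a real inner
  product space `E` with `[Fact (finrank ℝ E = n + 1)]` (as in
  `Mathlib.Geometry.Manifold.Instances.Sphere`) and an arbitrary normed parameter space of the
  surface; at `E = ℝ⁴` the `Fact` is supplied inside the proofs by the tree's
  `fact_finrank_euclideanSpace_succ` (`ClosedBall.lean`), not as a local instance. No notation
  is declared: `Metric.sphere (0 : EuclideanSpace ℝ (Fin (3 + 1))) 1` is the `𝕊 3` of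
  `Knots.lean`.
* No statement of `BandSum.lean` is modified; no declaration uses `sorry`.
-/

open scoped Manifold ContDiff Topology
open Function Set

noncomputable section

namespace Literature.Topology.FourManifolds

/-! ### Ambient velocities through smooth maps of a sphere -/

section Velocity

open Metric Module

variable {E : Type*} [NormedAddCommGroup E] [InnerProductSpace ℝ E] {n : ℕ}
  [Fact (finrank ℝ E = n + 1)] {F F' : Type*} [NormedAddCommGroup F] [NormedSpace ℝ F]
  [NormedAddCommGroup F'] [NormedSpace ℝ F']

/-- Chain rule, read in a vector space: for `β : F → S` (`S` the unit sphere of the inner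
product space `E`) differentiable at `p` and `ψ : S → F'` differentiable at `β p`, the Fréchet
derivative of `ψ ∘ β` at `p` is `dψ(β p) ∘ dβ(p)` (Mathlib `mfderiv_comp`, `mfderiv_eq_fderiv`).
[folklore] -/
theorem fderiv_comp_sphere_apply {ψ : sphere (0 : E) 1 → F'} {β : F → sphere (0 : E) 1} {p : F}
    (hψ : MDifferentiableAt (𝓡 n) 𝓘(ℝ, F') ψ (β p)) (hβ : MDifferentiableAt 𝓘(ℝ, F) (𝓡 n) β p)
    (v : F) :
    fderiv ℝ (fun x ↦ ψ (β x)) p v =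
      mfderiv (𝓡 n) 𝓘(ℝ, F') ψ (β p) (mfderiv 𝓘(ℝ, F) (𝓡 n) β p v) := by
  have h := mfderiv_comp p hψ hβ
  have e : fderiv ℝ (fun x ↦ ψ (β x)) p = mfderiv 𝓘(ℝ, F) 𝓘(ℝ, F') (ψ ∘ β) p :=
    mfderiv_eq_fderiv.symm
  rw [e, h]
  rfl

/-- Chain rule for a curve, read in a vector space: for `γ : ℝ → S` differentiable at `θ` and
`ψ : S → F'` differentiable at `γ θ`, the velocity of `ψ ∘ γ` at `θ` is `dψ(γ θ) (dγ(θ) 1)`.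
[folklore] -/
theorem deriv_comp_sphere {ψ : sphere (0 : E) 1 → F'} {γ : ℝ → sphere (0 : E) 1} {θ : ℝ}
    (hψ : MDifferentiableAt (𝓡 n) 𝓘(ℝ, F') ψ (γ θ)) (hγ : MDifferentiableAt 𝓘(ℝ, ℝ) (𝓡 n) γ θ) :
    deriv (fun t ↦ ψ (γ t)) θ =
      mfderiv (𝓡 n) 𝓘(ℝ, F') ψ (γ θ) (mfderiv 𝓘(ℝ, ℝ) (𝓡 n) γ θ (1 : ℝ)) := by
  rw [← fderiv_apply_one_eq_deriv]
  exact fderiv_comp_sphere_apply hψ hγ 1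

/-- **Velocity relations in the ambient space survive smooth maps of the sphere.** Let `S` be
the unit sphere of the inner product space `E`, `γ : ℝ → S` a curve and `β : F → S` a map,
differentiable at `θ` and at `p`, through the same point `γ θ = β p`, and suppose that in the
ambient space `E` the velocity of `γ` at `θ` is `c` times the derivative of `β` at `p` in the
direction `v`. Then the same relation holds between `φ ∘ γ` and `φ ∘ β` for every smooth
`φ : S → S`: the differential of `S ⊆ E` is injective (Mathlib `mfderiv_coe_sphere_injective`),
so already `dγ(θ) 1 = c • dβ(p) v` in `T_{γ θ} S`, and `d(ι ∘ φ)` is linear (`ι : S ⊆ E`).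
(Used for the orientation clauses of `BandData`.) [folklore] -/
theorem deriv_coe_comp_eq_smul_fderiv_coe_comp {φ : sphere (0 : E) 1 → sphere (0 : E) 1}
    (hφ : ContMDiff (𝓡 n) (𝓡 n) ∞ φ) {γ : ℝ → sphere (0 : E) 1} {θ : ℝ}
    (hγ : MDifferentiableAt 𝓘(ℝ, ℝ) (𝓡 n) γ θ) {β : F → sphere (0 : E) 1} {p : F}
    (hβ : MDifferentiableAt 𝓘(ℝ, F) (𝓡 n) β p) {v : F} {c : ℝ} (hpt : γ θ = β p)
    (h : deriv (fun t ↦ ((γ t : sphere (0 : E) 1) : E)) θ =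
      c • fderiv ℝ (fun x ↦ ((β x : sphere (0 : E) 1) : E)) p v) :
    deriv (fun t ↦ ((φ (γ t) : sphere (0 : E) 1) : E)) θ =
      c • fderiv ℝ (fun x ↦ ((φ (β x) : sphere (0 : E) 1) : E)) p v := by
  have hn : (∞ : ℕ∞ω) ≠ 0 := by simp
  have hval : ∀ y : sphere (0 : E) 1,
      MDifferentiableAt (𝓡 n) 𝓘(ℝ, E) (Subtype.val : sphere (0 : E) 1 → E) y :=
    fun y ↦ (contMDiff_coe_sphere (m := ∞)).mdifferentiableAt hn
  have hvalφ : ∀ y : sphere (0 : E) 1,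
      MDifferentiableAt (𝓡 n) 𝓘(ℝ, E) (fun z ↦ ((φ z : sphere (0 : E) 1) : E)) y :=
    fun y ↦ ((contMDiff_coe_sphere (m := ∞)).comp hφ).mdifferentiableAt hn
  -- the relation between the tangent vectors, then pushed forward by `d(ι ∘ φ)`
  have key : ∀ (y y' : sphere (0 : E) 1), y = y' →
      ∀ (u : TangentSpace (𝓡 n) y) (w : TangentSpace (𝓡 n) y'),
      mfderiv (𝓡 n) 𝓘(ℝ, E) (Subtype.val : sphere (0 : E) 1 → E) y u =
        c • mfderiv (𝓡 n) 𝓘(ℝ, E) (Subtype.val : sphere (0 : E) 1 → E) y' w →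
      mfderiv (𝓡 n) 𝓘(ℝ, E) (fun z ↦ ((φ z : sphere (0 : E) 1) : E)) y u =
        c • mfderiv (𝓡 n) 𝓘(ℝ, E) (fun z ↦ ((φ z : sphere (0 : E) 1) : E)) y' w := by
    rintro y _ rfl u w huw
    rw [← map_smul] at huw
    rw [mfderiv_coe_sphere_injective (n := n) y huw, map_smul]
  have e1 := deriv_comp_sphere (hval _) hγ
  have e2 := fderiv_comp_sphere_apply (hval _) hβ v
  have e3 := deriv_comp_sphere (hvalφ _) hγ
  have e4 := fderiv_comp_sphere_apply (hvalφ _) hβ v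
  rw [e1, e2] at h
  rw [e3, e4]
  exact key _ _ hpt _ _ h

end Velocity

/-! ### Transport of band-sum data along a diffeomorphism of `𝕊³` -/

/-- Preimages of images: `(φ ∘ f) ⁻¹' range (φ ∘ g) = f ⁻¹' range g` for injective `φ`.
[folklore] -/
theorem preimage_comp_range_comp {α β X Y : Type*} {φ : X → Y} (hφ : Injective φ) (f : α → X)
    (g : β → X) : (φ ∘ f) ⁻¹' range (φ ∘ g) = f ⁻¹' range g := by
  ext x
  simp only [mem_preimage, mem_range, comp_apply, hφ.eq_iff]

namespace BandData

variable {K₁ K₂ K : Knot}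

/-- **Transport of band-sum data along a diffeomorphism `φ` of `𝕊³`.** If `K` is the band sum
of `K₁`, `K₂` along `band` (collar width `δ`, planar arcs `lowerArc`, `upperArc`), then `φ ∘ K`
is the band sum of `φ ∘ K₁`, `φ ∘ K₂` along `φ ∘ band` with the same collar width (and the same
planar arcs); stated as the existence of such band-sum data, recording the band and the width.
The set-theoretic clauses transport by injectivity of `φ`, the immersion clause by the chain
rule and invertibility of `dφ`, the orientation clauses by
`deriv_coe_comp_eq_smul_fderiv_coe_comp`. (Stated for `avoid = ∅`, the case of connected sums.)
Rolfsen (1976), §2.G; Cromwell (2004), §4.6. [folklore] -/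
theorem exists_map (b : BandData K₁ K₂ K ∅)
    (φ : (Metric.sphere (0 : EuclideanSpace ℝ (Fin (3 + 1))) 1) ≃ₘ⟮𝓡 3, 𝓡 3⟯
      (Metric.sphere (0 : EuclideanSpace ℝ (Fin (3 + 1))) 1)) :
    ∃ b' : BandData (K₁.map φ) (K₂.map φ) (K.map φ) ∅, b'.band = φ ∘ b.band ∧ b'.δ = b.δ :=
  have hφ : Injective ⇑φ := φ.injective
  ⟨{ band := φ ∘ b.band
     δ := b.δ
     δ_pos := b.δ_pos
     contMDiff := φ.contMDiff.comp b.contMDiff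
     injOn := hφ.comp_injOn b.injOn
     injective_mfderiv x hx := by
       have hn : (∞ : ℕ∞ω) ≠ 0 := by simp
       rw [mfderiv_comp x (φ.contMDiff.mdifferentiableAt hn) (b.contMDiff.mdifferentiableAt hn)]
       exact (φ.mfderivToContinuousLinearEquiv hn (b.band x)).injective.comp
         (b.injective_mfderiv x hx)
     disjoint_avoid := disjoint_empty _
     preimage_left := by
       rw [SphereEmbedding.coe_map, preimage_comp_range_comp hφ, b.preimage_left]
     preimage_right := by
       rw [SphereEmbedding.coe_map, preimage_comp_range_comp hφ, b.preimage_right]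
     range_diff := by
       simp only [SphereEmbedding.coe_map, range_comp, image_comp]
       rw [← image_union, ← image_sdiff hφ, ← image_sdiff hφ, b.range_diff]
     lowerArc := b.lowerArc
     upperArc := b.upperArc
     contDiff_lowerArc := b.contDiff_lowerArc
     contDiff_upperArc := b.contDiff_upperArc
     injOn_lowerArc := b.injOn_lowerArc
     injOn_upperArc := b.injOn_upperArc
     deriv_lowerArc_ne_zero := b.deriv_lowerArc_ne_zero
     deriv_upperArc_ne_zero := b.deriv_upperArc_ne_zero
     lowerArc_zero := b.lowerArc_zero
     lowerArc_one := b.lowerArc_one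
     upperArc_zero := b.upperArc_zero
     upperArc_one := b.upperArc_one
     lowerArc_mem := b.lowerArc_mem
     upperArc_mem := b.upperArc_mem
     preimage_range := by
       rw [SphereEmbedding.coe_map, preimage_comp_range_comp hφ, b.preimage_range]
     orient_left := by
       have hn : (∞ : ℕ∞ω) ≠ 0 := by simp
       have := fact_finrank_euclideanSpace_succ 1
       have := fact_finrank_euclideanSpace_succ 3
       obtain ⟨θ, c, hc, hpt, hder⟩ := b.orient_left
       refine ⟨θ, c, hc, congrArg φ hpt, ?_⟩
       exact deriv_coe_comp_eq_smul_fderiv_coe_comp (γ := fun t ↦ K₁ (circlePoint t)) φ.contMDiff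
         ((K₁.contMDiff.comp (contDiff_coe_circlePoint.contMDiff.codRestrict_sphere
           fun t ↦ (circlePoint t).2)).mdifferentiableAt hn)
         (b.contMDiff.mdifferentiableAt hn) hpt hder
     orient_right := by
       have hn : (∞ : ℕ∞ω) ≠ 0 := by simp
       have := fact_finrank_euclideanSpace_succ 1
       have := fact_finrank_euclideanSpace_succ 3
       obtain ⟨θ, c, hc, hpt, hder⟩ := b.orient_right
       refine ⟨θ, c, hc, congrArg φ hpt, ?_⟩
       exact deriv_coe_comp_eq_smul_fderiv_coe_comp (γ := fun t ↦ K₂ (circlePoint t)) φ.contMDiff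
         ((K₂.contMDiff.comp (contDiff_coe_circlePoint.contMDiff.codRestrict_sphere
           fun t ↦ (circlePoint t).2)).mdifferentiableAt hn)
         (b.contMDiff.mdifferentiableAt hn) hpt hder
     orient_result := by
       have hn : (∞ : ℕ∞ω) ≠ 0 := by simp
       have := fact_finrank_euclideanSpace_succ 1
       have := fact_finrank_euclideanSpace_succ 3
       obtain ⟨θ, c, hc, hpt, hder⟩ := b.orient_result
       refine ⟨θ, c, hc, congrArg φ hpt, ?_⟩
       exact deriv_coe_comp_eq_smul_fderiv_coe_comp (γ := fun t ↦ K (circlePoint t)) φ.contMDiff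
         ((K.contMDiff.comp (contDiff_coe_circlePoint.contMDiff.codRestrict_sphere
           fun t ↦ (circlePoint t).2)).mdifferentiableAt hn)
         (b.contMDiff.mdifferentiableAt hn) hpt hder }, rfl, rfl⟩

end BandData

namespace Knot

/-- A band sum (avoiding nothing) is transported to a band sum by any diffeomorphism of `𝕊³`.
[folklore] -/
theorem IsBandSum.map {K₁ K₂ K : Knot} (h : IsBandSum K₁ K₂ K ∅)
    (φ : (Metric.sphere (0 : EuclideanSpace ℝ (Fin (3 + 1))) 1) ≃ₘ⟮𝓡 3, 𝓡 3⟯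
      (Metric.sphere (0 : EuclideanSpace ℝ (Fin (3 + 1))) 1)) :
    IsBandSum (K₁.map φ) (K₂.map φ) (K.map φ) ∅ :=
  let ⟨b⟩ := h; let ⟨b', _⟩ := b.exists_map φ; ⟨b'⟩

/-- **Splitting spheres are transported by diffeomorphisms of `𝕊³`**: if `S` splits `K₁` from
`K₂` then `φ ∘ S` splits `φ ∘ K₁` from `φ ∘ K₂` (a path between the images missing `φ ∘ S` would
pull back along `φ⁻¹` to a path between `K₁` and `K₂` missing `S`). Rolfsen (1976), §4.B.
[folklore] -/
theorem IsSplitBy.map {S : SphereEmbedding 2 3} {K₁ K₂ : Knot} (h : IsSplitBy S K₁ K₂)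
    (φ : (Metric.sphere (0 : EuclideanSpace ℝ (Fin (3 + 1))) 1) ≃ₘ⟮𝓡 3, 𝓡 3⟯
      (Metric.sphere (0 : EuclideanSpace ℝ (Fin (3 + 1))) 1)) :
    IsSplitBy (S.map φ) (K₁.map φ) (K₂.map φ) := by
  have hφ : Injective ⇑φ := φ.injective
  refine ⟨?_, fun γ ↦ ?_⟩
  · rw [SphereEmbedding.range_map, SphereEmbedding.range_map, SphereEmbedding.range_map,
      ← image_union]
    exact (disjoint_image_iff hφ).2 h.1
  · -- pull the path back along `φ⁻¹`
    let γ' : Path (K₁ (circlePoint 0)) (K₂ (circlePoint 0)) :=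
      (γ.map φ.symm.continuous).cast (φ.symm_apply_apply _).symm (φ.symm_apply_apply _).symm
    obtain ⟨z, ⟨t, rfl⟩, ⟨s, hs⟩⟩ := h.2 γ'
    refine ⟨γ t, ⟨t, rfl⟩, ⟨s, ?_⟩⟩
    have hs' : S s = φ.symm (γ t) := hs
    simp only [SphereEmbedding.coe_map, comp_apply, hs', Diffeomorph.apply_symm_apply]

/-- Split links are transported to split links by diffeomorphisms of `𝕊³`. [folklore] -/
theorem IsSplit.map {K₁ K₂ : Knot} (h : IsSplit K₁ K₂)
    (φ : (Metric.sphere (0 : EuclideanSpace ℝ (Fin (3 + 1))) 1) ≃ₘ⟮𝓡 3, 𝓡 3⟯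
      (Metric.sphere (0 : EuclideanSpace ℝ (Fin (3 + 1))) 1)) :
    IsSplit (K₁.map φ) (K₂.map φ) :=
  h.imp' (fun S ↦ S.map φ) fun _ hS ↦ hS.map φ

/-- **Connected sums are transported by end stages of ambient isotopies**: if `K` is a connected
sum `K₁ # K₂` and `F` is an ambient isotopy of `𝕊³`, then `F₁ ∘ K` is a connected sum `K₁ # K₂`
(transport the isotopic copies, the splitting sphere and the band by `F₁`; the copies stay in the
isotopy classes of the factors by transitivity of ambient isotopy,
`IsAmbientIsotopic.trans_holds`). Rolfsen (1976), §2.G. [folklore] -/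
theorem IsConnectedSum.map_toDiffeomorph {K₁ K₂ K : Knot} (h : IsConnectedSum K₁ K₂ K)
    (F : AmbientIsotopy (𝓡 3) (Metric.sphere (0 : EuclideanSpace ℝ (Fin (3 + 1))) 1)) :
    IsConnectedSum K₁ K₂ (K.map (F.toDiffeomorph 1)) := by
  obtain ⟨K₁', K₂', h₁, h₂, S, b, hS, hcross⟩ := h
  obtain ⟨b', hband, hδ⟩ := b.exists_map (F.toDiffeomorph 1)
  refine ⟨K₁'.map (F.toDiffeomorph 1), K₂'.map (F.toDiffeomorph 1),
    IsAmbientIsotopic.trans_holds h₁ (K₁'.isIsotopic_map F),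
    IsAmbientIsotopic.trans_holds h₂ (K₂'.isIsotopic_map F),
    S.map (F.toDiffeomorph 1), b', hS.map (F.toDiffeomorph 1), ?_⟩
  have hφ : Injective ⇑(F.toDiffeomorph 1) := (F.toDiffeomorph 1).injective
  rw [hband, hδ, SphereEmbedding.coe_map, preimage_comp_range_comp hφ, hcross]

/-- **Discharge** of `Literature.Topology.FourManifolds.Knot.IsConnectedSum.of_isIsotopic_right`: a knot ambient isotopic to a
connected sum `K₁ # K₂` is itself a connected sum `K₁ # K₂` — write `K' = F₁ ∘ K` for the end
stage `F₁` of the ambient isotopy and transport the whole connected-sum configuration (isotopic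
copies of the factors, splitting sphere, band, with the same collar and planar arcs) by the
diffeomorphism `F₁` (`IsConnectedSum.map_toDiffeomorph`). This is the remark that the connected
sum is an operation on oriented knot types: Rolfsen, *Knots and Links* (1976), §2.G; in the
band-on-a-split-link form of `BandSum.lean`, Cromwell, *Knots and Links* (2004), §4.6 (product
of oriented knots along a rectangle meeting the separating sphere in one arc; "=" meaning
orientation-preserving ambient isotopy, footnote in §4.6, PDF p. 69 of the held copy).
[cite: Rolfsen1976, §2.G] -/
theorem IsConnectedSum.of_isIsotopic_right_holds : IsConnectedSum.of_isIsotopic_right := by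
  intro K₁ K₂ K K' hsum hiso
  obtain ⟨F, hF⟩ := hiso
  obtain rfl : K' = K.map (F.toDiffeomorph 1) :=
    DFunLike.coe_injective (by rw [SphereEmbedding.coe_map, AmbientIsotopy.coe_toDiffeomorph, hF])
  exact hsum.map_toDiffeomorph F

end Knot

end Literature.Topology.FourManifolds
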